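import Summits.QuantumFields.YangMills.Theorems.ParabolicTrajectoryTunedSequenceExistsQFemtoBridge

/-!
# Crux `TunedSequenceExists` (stmt-QuantumFields-10524) vs the sibling crux `FemtoCurvatureTwoPointC`
# (stmt-QuantumFields-16204): (U_Q,∃h) ⟸ the sibling crux, and the ONE-NEW-CHILD reduction
# `FemtoCurvatureTwoPointC → VolumeMonotoneQRelAll → TunedSequenceExistsQ` (lead c5; recipe of lead c4 §24, executed)

`femtoLowerBoundQ_of_cruxCAtWith`: if `(a, Γ, β₀, ℓ₀, c, C)` carry the sibling's femto two-point package at `(G, r)` with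
`a` continuous, then for every `M ≥ 2` the pinned-aspect window for the time-zero plaquette `Q` holds with aspect floor
`LU = 4` and height `h(L₁) = c · Γ(ℓ₀ / (2 L₁ + 1)) > 0`: given floors `B, m₀`, take `n = M^m` deep enough that
`s⋆/n ≤ a(max B β₀)` (`s⋆ := ℓ₀/(2L₁+1)`), solve `a β = s⋆/n` with `β ≥ max B β₀` (IVT on the continuous unit map), and read
clause 1 of the sibling on the torus `2 L₁ n + 1`, which is femto because `(2L₁n+1)·a β ≤ (2L₁+1)·s⋆ = ℓ₀`, at separation
`n` (`8n ≤ 2L₁n+1` as `L₁ ≥ 4`): `h = c·Γ(n · a β) ≤ n⁸ ⟨Q;τ_nQ⟩`.  Hence `FemtoCurvatureTwoPointC ⇒ (U_Q,∃h)` for all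
admissible data (`femtoLowerBoundQ_of_femtoCurvatureTwoPointC`); with (V_Q,rel) the window lower bound for `Q`
(`coreQ_of_femtoLower_of_volumeRel`, `θ₀ = h(L₁)/K`) and, by the landed IVT/RP glue of `…RPDiagonalVariant`, the
`Q`-restated crux: `tunedSequenceExistsQ_of_femtoC_of_volumeRel`.

What does NOT transfer (recorded, not claimed): the height `c / log² L₁` of the registered P-stub `stub_femtoWindow` /
of `RPDiagonalVariant.FemtoWindowQ` (it would need `Γ(s) ≳ 1/log²(1/s)`, which the sibling does not assert), and any
lower bound for the CORNER density `P` of the crux as filed (one channel of 36; the cross channels are only `|·|`-bounded).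
-/

noncomputable section

open Filter Topology MeasureTheory
open Literature.MathematicalPhysics.QuantumFieldTheory Literature.MathematicalPhysics.QuantumLattice

namespace Summit.QuantumFields.YangMills.Theorems.TunedSequenceExists.QFemto

open RPDiagonalVariant (spatialPlaquette)

variable {G : Type} [Group G] [TopologicalSpace G] [IsTopologicalGroup G] [CompactSpace G]
  [MeasurableSpace G] [BorelSpace G]

/-- **(U_Q,∃h) from the sibling's package at given data.** See the module docstring for the proof. -/
theorem femtoLowerBoundQ_of_cruxCAtWith (r : LatticeRep G) {a Γ : ℝ → ℝ} {β₀ ℓ₀ c C : ℝ}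
    (h : CruxCAtWith r a Γ β₀ ℓ₀ c C) (ha : Continuous a) {M : ℕ} (hM : 2 ≤ M) :
    FemtoLowerBoundQ r M := by
  have hℓ₀ := h.1
  have hc := h.2.1
  have hapos := h.2.2.1
  have hatend := h.2.2.2.1
  have hΓ := h.2.2.2.2.1
  have hM1 : (1 : ℝ) < M := by exact_mod_cast hM
  refine ⟨4, fun L₁ hL₁ => ?_⟩
  -- the pinned physical separation `s⋆ = ℓ₀ / (2 L₁ + 1)` and the height `h = c Γ(s⋆)`
  set s : ℝ := ℓ₀ / (2 * L₁ + 1) with hs_def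
  have hL₁pos : (0 : ℝ) < 2 * L₁ + 1 := by positivity
  have hs : 0 < s := div_pos hℓ₀ hL₁pos
  have hsℓ : s ≤ ℓ₀ := by
    rw [hs_def, div_le_iff₀ hL₁pos]
    have h1 : (1 : ℝ) ≤ 2 * L₁ + 1 := by linarith [(Nat.cast_nonneg L₁ : (0 : ℝ) ≤ L₁)]
    nlinarith
  refine ⟨c * Γ s, mul_pos hc (hΓ s hs hsℓ).1, fun B m₀ => ?_⟩
  -- floors: couple beyond `B' = max B β₀`, depth beyond `m₀` and deep enough that `s / M^m ≤ a B'`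
  set B' : ℝ := max B β₀ with hB'
  have haB' := hapos B'
  obtain ⟨m₁, hm₁⟩ := eventually_atTop.1
    ((tendsto_pow_atTop_atTop_of_one_lt hM1).eventually (eventually_ge_atTop (s / a B')))
  set m : ℕ := max m₀ m₁ with hm_def
  have hpow : s / a B' ≤ (M : ℝ) ^ m := hm₁ m (le_max_right _ _)
  have hMm_pos : (0 : ℝ) < (M : ℝ) ^ m := by positivity
  set n : ℕ := M ^ m with hn_def
  have hn_cast : (n : ℝ) = (M : ℝ) ^ m := by rw [hn_def]; push_cast; ring
  have hn_pos : (0 : ℝ) < n := by rw [hn_cast]; exact hMm_pos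
  have hn1 : 1 ≤ n := Nat.one_le_pow _ _ (by omega)
  -- solve `a β = s / n` beyond the floor
  have hsn : 0 < s / n := div_pos hs hn_pos
  have hsnB : s / n ≤ a B' := by
    rw [div_le_iff₀ hn_pos, hn_cast]
    rw [div_le_iff₀ haB'] at hpow
    linarith [mul_comm (a B') ((M : ℝ) ^ m)]
  obtain ⟨β, hB'β, hβs⟩ := exists_ge_unitMap_eq ha hatend B' hsn hsnB
  have hBβ : B ≤ β := (le_max_left _ _).trans hB'β
  have hβ₀ : β₀ ≤ β := (le_max_right _ _).trans hB'β
  refine ⟨m, le_max_left _ _, β, hBβ, ?_⟩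
  -- the torus `2 L₁ n + 1` is femto and `8 n ≤ 2 L₁ n + 1`
  have hfem : ((2 * (L₁ * M ^ m) + 1 : ℕ) : ℝ) * a β ≤ ℓ₀ := by
    rw [hβs]
    have h1 : ((2 * (L₁ * M ^ m) + 1 : ℕ) : ℝ) ≤ (2 * L₁ + 1) * n := by
      rw [← hn_def]; push_cast
      have : (1 : ℝ) ≤ n := by exact_mod_cast hn1
      nlinarith [(Nat.cast_nonneg L₁ : (0 : ℝ) ≤ L₁)]
    calc ((2 * (L₁ * M ^ m) + 1 : ℕ) : ℝ) * (s / n)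
        ≤ (2 * L₁ + 1) * n * (s / n) := mul_le_mul_of_nonneg_right h1 hsn.le
      _ = (2 * L₁ + 1) * s := by field_simp
      _ = ℓ₀ := by rw [hs_def]; field_simp
  have h8 : 8 * n ≤ 2 * (L₁ * M ^ m) + 1 := by
    rw [← hn_def]
    have : 8 * n ≤ 2 * (L₁ * n) := by nlinarith
    omega
  have hwin := (axis_window_of_cruxCAtWith r h (2 * (L₁ * M ^ m) + 1) hβ₀ hfem hn1 h8).1
  have hns : (n : ℝ) * a β = s := by
    rw [hβs]; field_simp
  rw [hns, hn_cast] at hwin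
  exact hwin

/-- **`FemtoCurvatureTwoPointC ⇒ (U_Q,∃h)`** for every compact simple `G` (Borel structure `borel G`), every `r`, every
`M ≥ 2`. -/
theorem femtoLowerBoundQ_of_femtoCurvatureTwoPointC
    (hF : Summit.QuantumFields.YangMills.Theses.LangevinControlUV.FemtoCurvatureTwoPointC) :
    ∀ (G : Type) [Group G] [TopologicalSpace G] [IsTopologicalGroup G] [CompactSpace G],
      IsCompactSimpleLieGroup G → letI : MeasurableSpace G := borel G
      haveI : BorelSpace G := ⟨rfl⟩
      ∀ (r : LatticeRep G) (M : ℕ), 2 ≤ M → FemtoLowerBoundQ r M := by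
  intro G _ _ _ _ hG
  letI : MeasurableSpace G := borel G
  haveI : BorelSpace G := ⟨rfl⟩
  intro r M hM
  obtain ⟨a, ha, Γ, β₀, ℓ₀, c, C, h⟩ :=
    (cruxCAt_iff_exists_with r).1 ((FemtoCurvatureTwoPointC.femtoCurvatureTwoPointC_iff.1 hF) G hG r)
  exact femtoLowerBoundQ_of_cruxCAtWith r h ha hM


/-! ## The one-new-child reduction of the `Q`-restated crux -/

/-- **(U_Q,∃h) + (V_Q,rel) ⇒ the window lower bound for `Q`** (quantifier arithmetic: fix the aspect
`L₁ = max LU LV` BEFORE the floors; height `h(L₁)`, factor `K`, window height `θ₀ = h / K`). -/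
theorem coreQ_of_femtoLower_of_volumeRel (r : LatticeRep G) {M : ℕ} (hU : FemtoLowerBoundQ r M)
    (hV : VolumeMonotoneQRel r M) :
    ∃ θ₀ : ℝ, 0 < θ₀ ∧ ∀ (B : ℝ) (m₀ L₀ : ℕ), ∃ m : ℕ, m₀ ≤ m ∧ ∃ L : ℕ, L₀ * M ^ m ≤ L ∧
      ∃ β : ℝ, B ≤ β ∧ θ₀ ≤ ((M : ℝ) ^ m) ^ 8 *
        latticeConnectedCorr r.ρ β (2 * L + 1) (spatialPlaquette r) (spatialPlaquette r) (M ^ m) := by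
  obtain ⟨LU, hU⟩ := hU
  obtain ⟨K, hK, LV, hV⟩ := hV
  set L₁ : ℕ := max LU LV with hL₁
  obtain ⟨h, hh, hU'⟩ := hU L₁ (le_max_left _ _)
  obtain ⟨β₁, m₁, hV'⟩ := hV L₁ (le_max_right _ _)
  refine ⟨h / K, div_pos hh hK, fun B m₀ L₀ => ?_⟩
  obtain ⟨m, hm, β, hβ, hu⟩ := hU' (max B β₁) (max m₀ m₁)
  refine ⟨m, (le_max_left _ _).trans hm, max L₀ L₁ * M ^ m, Nat.mul_le_mul_right _ (le_max_left _ _), β,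
    (le_max_left _ _).trans hβ, ?_⟩
  have hstep := hV' β m (max L₀ L₁ * M ^ m) ((le_max_right _ _).trans hβ) ((le_max_right _ _).trans hm)
    (Nat.mul_le_mul_right _ (le_max_right _ _))
  rw [div_le_iff₀ hK]
  linarith

/-- **The one-new-child reduction.** `FemtoCurvatureTwoPointC → VolumeMonotoneQRelAll → TunedSequenceExistsQ`: granted the
sibling tier-deciding crux (stmt-QuantumFields-16204), the `Q`-restated crux of route `ParabolicTrajectory` follows from ONE
further statement, the relative volume quasi-monotonicity (V_Q,rel) — exact tuning by the IVT and clause (iii) by reflection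
positivity are the landed `RPDiagonalVariant.weakQ_of_lowerBound` / `windowQ_of_weak`. -/
theorem tunedSequenceExistsQ_of_femtoC_of_volumeRel
    (hF : Summit.QuantumFields.YangMills.Theses.LangevinControlUV.FemtoCurvatureTwoPointC)
    (hV : VolumeMonotoneQRelAll) : RPDiagonalVariant.TunedSequenceExistsQ := by
  intro G _ _ _ _ hG
  letI : MeasurableSpace G := borel G
  haveI : BorelSpace G := ⟨rfl⟩
  intro r M hM
  have hU := femtoLowerBoundQ_of_femtoCurvatureTwoPointC hF G hG r M hM
  obtain ⟨θ₀, hθ₀, hweak⟩ := RPDiagonalVariant.weakQ_of_lowerBound r hM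
    (coreQ_of_femtoLower_of_volumeRel r hU (hV G hG r M hM))
  refine ⟨θ₀, hθ₀, fun θ hθ hθ' => ?_⟩
  obtain ⟨sch, n, hshape, hβ, hlim⟩ := hweak θ hθ hθ'
  exact RPDiagonalVariant.windowQ_of_weak r M θ sch n hshape hβ hlim

end Summit.QuantumFields.YangMills.Theorems.TunedSequenceExists.QFemto

end
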